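import Mathlib
import Literature.NumberTheory.Sieve.BrunTwinPrimes
import Literature.NumberTheory.Sieve.FriedlanderIwaniecPrimesCongrExpSum
import HarnessLib

/-!
# Maynard 2016: counting in a class modulo `P_w` with a coprime periodic side condition

Topic `Literature/NumberTheory/Sieve`. J. Maynard, *Large gaps between primes*, Ann. of Math. (2)
183 (2016), 915–933 = arXiv:1408.5110, §6, proofs of Lemmas 6 and 7, displays (6.6)–(6.8) and
(6.24)–(6.25): after splitting into classes `n ≡ a (mod P_w)`, the divisibility conditions
`d_j ∣ n + h_j q`, `e_j ∣ m(n + h_j q) − 1` (moduli coprime to `P_w`) single out residue classes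
modulo `P_w ∏ d_j e_j` "by the Chinese remainder theorem", and each class modulo `Q` contains
`N/Q + O(1)` integers `n ≤ N`.

PROVED here (no named facts), generic in the moduli: the product rule for the number of solutions
of two periodic conditions with coprime periods (`card_filter_range_mul_of_coprime`, from the CRT
bijection `FriedlanderIwaniecPrimes.sum_range_mul_coprime`), the conjunction's period
(`periodic_mod_eq_and`), one class has one solution (`card_filter_range_mod_eq`), and the count
`| #{1 ≤ n ≤ N : n ≡ a (mod P), R n} − N r/(P D) | ≤ r`, `r = #{0 ≤ b < D : R b}`, for a
`D`-periodic `R` with `(P, D) = 1` (`abs_card_class_and_sub_le`).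

## References

* J. Maynard, *Large gaps between primes*, Ann. of Math. (2) 183 (2016), 915–933; arXiv:1408.5110,
  §6 (6.6)–(6.8), (6.24)–(6.25). [Maynard2016LargeGaps]
-/

open Filter Finset
open scoped Topology

namespace Literature.NumberTheory.Sieve

namespace Maynard2016

/-- **CRT product rule.** For coprime `P, D ≥ 1`, `Q` `P`-periodic and `R` `D`-periodic:
`#{0 ≤ n < PD : Q n ∧ R n} = #{0 ≤ i < P : Q i} · #{0 ≤ j < D : R j}`. [cite: Maynard2016LargeGaps, §6 display (6.8) («by the Chinese remainder theorem»)] -/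
theorem card_filter_range_mul_of_coprime {P D : ℕ} (hP : 0 < P) (hD : 0 < D)
    (hPD : P.Coprime D) (Q R : ℕ → Prop) [DecidablePred Q] [DecidablePred R]
    (hQ : Function.Periodic Q P) (hR : Function.Periodic R D) :
    ((Finset.range (P * D)).filter (fun n => Q n ∧ R n)).card =
      ((Finset.range P).filter Q).card * ((Finset.range D).filter R).card := by
  classical
  have key := FriedlanderIwaniecPrimes.sum_range_mul_coprime hP hD hPD
    (fun i j => (if Q i then (1 : ℕ) else 0) * (if R j then 1 else 0))
  have hL : ∀ n, (if Q (n % P) then (1 : ℕ) else 0) * (if R (n % D) then 1 else 0) =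
      if Q n ∧ R n then 1 else 0 := by
    intro n
    have h1 : Q (n % P) = Q n := hQ.map_mod_nat n
    have h2 : R (n % D) = R n := hR.map_mod_nat n
    rw [ite_zero_mul_ite_zero, one_mul]
    simp only [h1, h2]
  simp only [hL] at key
  rw [Finset.sum_boole, Nat.cast_id] at key
  rw [key, ← Finset.sum_mul_sum, Finset.sum_boole, Finset.sum_boole, Nat.cast_id, Nat.cast_id]

/-- One class `a (mod P)` (`a < P`) has exactly one representative in `[0, P)`. [cite: Maynard2016LargeGaps, §6 display (6.6)] -/
theorem card_filter_range_mod_eq {P a : ℕ} (ha : a < P) :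
    ((Finset.range P).filter (fun n => n % P = a)).card = 1 := by
  have h : (Finset.range P).filter (fun n => n % P = a) = {a} := by
    ext n
    simp only [Finset.mem_filter, Finset.mem_range, Finset.mem_singleton]
    constructor
    · rintro ⟨hn, hna⟩
      rw [Nat.mod_eq_of_lt hn] at hna
      exact hna
    · rintro rfl
      exact ⟨ha, Nat.mod_eq_of_lt ha⟩
  rw [h, Finset.card_singleton]

/-- The conjunction `n ≡ a (mod P) ∧ R n` (`R` `D`-periodic) is `PD`-periodic. [cite: Maynard2016LargeGaps, §6 display (6.8)] -/
theorem periodic_mod_eq_and {P D : ℕ} (a : ℕ) (R : ℕ → Prop) (hR : Function.Periodic R D) :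
    Function.Periodic (fun n => n % P = a ∧ R n) (P * D) := by
  intro n
  have h1 : (n + P * D) % P = n % P := Nat.add_mul_mod_self_left n P D
  have h2 : R (n + P * D) = R n := by
    have := hR.nsmul P n
    rwa [smul_eq_mul] at this
  show ((n + P * D) % P = a ∧ R (n + P * D)) = (n % P = a ∧ R n)
  rw [h1, h2]

/-- **Counting in a class with a coprime side condition.** For coprime `P, D ≥ 1`, `a < P`, and a
`D`-periodic condition `R` with `r = #{0 ≤ b < D : R b}` solutions:
`| #{1 ≤ n ≤ N : n ≡ a (mod P) ∧ R n} − N r/(P D) | ≤ r`. [cite: Maynard2016LargeGaps, §6 displays (6.6)–(6.8), (6.24)–(6.25)] -/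
theorem abs_card_class_and_sub_le {P D : ℕ} (hP : 0 < P) (hD : 0 < D) (hPD : P.Coprime D)
    {a : ℕ} (ha : a < P) (R : ℕ → Prop) [DecidablePred R] (hR : Function.Periodic R D) (N : ℕ) :
    |(((Finset.Icc 1 N).filter (fun n => n % P = a ∧ R n)).card : ℝ) -
        (N : ℝ) * ((Finset.range D).filter R).card / ((P : ℝ) * D)| ≤
      ((Finset.range D).filter R).card := by
  classical
  have hPD0 : 0 < P * D := Nat.mul_pos hP hD
  have hper := periodic_mod_eq_and (P := P) a R hR
  have h := BrunTwinPrimes.abs_card_filter_Icc_sub_le hPD0 (fun n => n % P = a ∧ R n) hper N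
  have hcount : Nat.count (fun n => n % P = a ∧ R n) (P * D) = ((Finset.range D).filter R).card := by
    rw [Nat.count_eq_card_filter_range,
      card_filter_range_mul_of_coprime hP hD hPD (fun n => n % P = a) R
        (fun n => by show ((n + P) % P = a) = (n % P = a); rw [Nat.add_mod_right]) hR,
      card_filter_range_mod_eq ha, one_mul]
  rw [hcount] at h
  convert h using 3
  push_cast
  ring

end Maynard2016

end Literature.NumberTheory.Sieve
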